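import Summits.ValiantsHypothesis.ValiantsHypothesis.Theorems.BarrierLeverTransversalLiteralPairSplitBlocks
import Summits.ValiantsHypothesis.ValiantsHypothesis.Theses.BarrierLever

/-!
# Route BarrierLever — item `TransversalLiteralPairSplit` (R1, stmt-ValiantsHypothesis-19587),
# part 2/2: the block argument and the item, PROVED

Closing file (`--workitem stmt-ValiantsHypothesis-19587`; cell valiant-natproofs, rung V4, 𝒟-side;
prover seat val-np-p1; item typed by planner p1-g10, proof = the planner's plan «z-perturbation
of one entry + N(t) = diag(t,…,t,1,…,1)·M(1/t)»). Part 1/2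
(`…TransversalLiteralPairSplitBlocks.lean`) supplies the off-part `offPart`, the one-entry
perturbation formulas `det_submatrix_add_single` / `det_submatrix_add_single_of_ne` and the
genericity lemma `exists_common_witness`; the R2 file (`…TransversalTwinFreeReduction.lean`)
supplies the literal-block lift.

**The item (R1, literal-pair split).** Conventions of TT (item 19152):
`Θ_H[x, y] = det H[ρ_x, κ_y]`, GOOD = some `H` makes the layout matrix nonsingular. If the first
`k` row points have `a`-bit `β` and the last `m` have `¬β`, the first `k` column points have
`c`-bit `γ` and the last `m` have `¬γ`, then GOOD(projected `k`-block, one dimension down) ∧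
GOOD(`m`-block, same dimension) ⇒
GOOD(`u`, `w`) (`transversalLiteralPairSplit`, signature VERBATIM;
`transversalLiteralPairSplit_route`, typed by the route declaration).

**Proof.** GENERICITY gives one big `H₂` with the `m`-block `D₀ = Θ_{H₂}[U₂, W₂]` nonsingular and
the projected `k`-block `C' = Θ_{offPart H₂}[U₁', W₁']` nonsingular. Perturb the single entry
(literal `(a, β)`, literal `(c, γ)`) of `H₂` by `z`: only the `k × k` block of the layout matrix
changes, by `z · (−1)^{a+c} · C'`, so after re-indexing `Fin (k+m) ≃ Fin k ⊕ Fin m` the layout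
matrix is `[[A₀ + z C₀, B₀], [B₁, D₀]]` with `det C₀ ≠ 0 ≠ det D₀`. BLOCK ARGUMENT
(`exists_det_fromBlocks_ne_zero`): `N(t) = [[t A₀ + C₀, t B₀], [B₁, D₀]]` has polynomial
determinant with `det N(0) = det C₀ · det D₀ ≠ 0` (`Matrix.det_fromBlocks_zero₁₂`), so some
`t ≠ 0` is not a root (`ℂ` is infinite), and `N(t) = diag(t·1, 1) · [[A₀ + t⁻¹ C₀, B₀], [B₁, D₀]]`
(`Matrix.fromBlocks_multiply`) gives `z = t⁻¹`. §3 records the general COLUMN- and ROW-LITERAL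
EXPANSIONS `Θ_H[x,y] = Σ_b (−1)^{b+c} H[ρ_x b, κ_y c] Θ_{offPart b c H}[x⁽ᵇ⁾, y⁽ᶜ⁾]` (Laplace),
of which the lift (R2) and the one-entry perturbation (R1) are the one-term cases — a tool for
further
reductions of the irreducible core.

WHAT THIS IS NOT: one of the two algebraic reductions (R1/R2) cutting TT down to its irreducible
core (item 19616, a CONJECTURE); nothing on the core, on TT / TNS / item 19717 in general, on crux
stmt-ValiantsHypothesis-14610, or on `VP` versus `VNP`.
-/

-- layout Summits/ValiantsHypothesis/ValiantsHypothesis forces the duplicated namespace component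
set_option linter.dupNamespace false

namespace Summit.ValiantsHypothesis.ValiantsHypothesis.Theorems.BarrierLever.LiteralSplit

open Finset Polynomial
open Summit.ValiantsHypothesis.ValiantsHypothesis.Theorems.BarrierLever.NearPrincipal
open Summit.ValiantsHypothesis.ValiantsHypothesis.Theorems.BarrierLever.Descent (rowL colL
  rowDec_rowL colDec_colL)
open Summit.ValiantsHypothesis.ValiantsHypothesis.Theorems.BarrierLever.LiteralLift

variable {h : ℕ}

/-! ## 1. The block argument: a perturbed diagonal block of full generic rank -/

/-- If `det C₀ ≠ 0` and `det D₀ ≠ 0` then for some `z` the block matrix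
`[[A₀ + z C₀, B₀], [B₁, D₀]]` is nonsingular: with `N(t) = [[t A₀ + C₀, t B₀], [B₁, D₀]]`,
`det N(t)` is a polynomial in `t` with `det N(0) = det C₀ · det D₀ ≠ 0`, so some `t ≠ 0` is not a
root, and `N(t) = diag(t, …, t, 1, …, 1) · [[A₀ + t⁻¹ C₀, B₀], [B₁, D₀]]`. -/
theorem exists_det_fromBlocks_ne_zero {k m : ℕ} (A₀ C₀ : Matrix (Fin k) (Fin k) ℂ)
    (B₀ : Matrix (Fin k) (Fin m) ℂ) (B₁ : Matrix (Fin m) (Fin k) ℂ) (D₀ : Matrix (Fin m) (Fin m) ℂ)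
    (hC : C₀.det ≠ 0) (hD : D₀.det ≠ 0) :
    ∃ z : ℂ, (Matrix.fromBlocks (A₀ + z • C₀) B₀ B₁ D₀).det ≠ 0 := by
  classical
  -- the polynomial matrix `N(X)`
  set Np : Matrix (Fin k ⊕ Fin m) (Fin k ⊕ Fin m) ℂ[X] :=
    Matrix.fromBlocks ((X : ℂ[X]) • A₀.map Polynomial.C + C₀.map Polynomial.C)
      ((X : ℂ[X]) • B₀.map Polynomial.C) (B₁.map Polynomial.C) (D₀.map Polynomial.C) with hNp
  have heval : ∀ t : ℂ, (Np.det).eval t =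
      (Matrix.fromBlocks (t • A₀ + C₀) (t • B₀) B₁ D₀).det := by
    intro t
    have h1 : (Np.det).eval t = ((Polynomial.evalRingHom t).mapMatrix Np).det := by
      rw [← RingHom.map_det]; rfl
    rw [h1]
    congr 1
    ext i j
    rw [RingHom.mapMatrix_apply, Matrix.map_apply, hNp]
    rcases i with i | i <;> rcases j with j | j
    · simp [Matrix.fromBlocks_apply₁₁]
      ring
    · simp [Matrix.fromBlocks_apply₁₂]
      ring
    · simp [Matrix.fromBlocks_apply₂₁]
    · simp [Matrix.fromBlocks_apply₂₂]
  have h0 : (Np.det).eval 0 ≠ 0 := by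
    rw [heval, zero_smul, zero_add, zero_smul, Matrix.det_fromBlocks_zero₁₂]
    exact mul_ne_zero hC hD
  have hNp0 : Np.det ≠ 0 := fun hz => h0 (by rw [hz, Polynomial.eval_zero])
  -- a nonzero non-root `t`
  obtain ⟨t, ht⟩ := Infinite.exists_notMem_finset (insert (0 : ℂ) (Np.det).roots.toFinset)
  rw [Finset.mem_insert, not_or, Multiset.mem_toFinset, Polynomial.mem_roots hNp0] at ht
  obtain ⟨ht0, hroot⟩ := ht
  have hdet : (Matrix.fromBlocks (t • A₀ + C₀) (t • B₀) B₁ D₀).det ≠ 0 := by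
    rw [← heval]; exact hroot
  -- factor out `diag(t, …, t, 1, …, 1)`
  have hfac : Matrix.fromBlocks (t • A₀ + C₀) (t • B₀) B₁ D₀ =
      Matrix.fromBlocks (t • (1 : Matrix (Fin k) (Fin k) ℂ)) 0 0 (1 : Matrix (Fin m) (Fin m) ℂ) *
        Matrix.fromBlocks (A₀ + t⁻¹ • C₀) B₀ B₁ D₀ := by
    rw [Matrix.fromBlocks_multiply]
    simp only [Matrix.smul_mul, Matrix.one_mul, Matrix.zero_mul, add_zero, zero_add, smul_add,
      smul_smul, mul_inv_cancel₀ ht0, one_smul]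
  refine ⟨t⁻¹, fun hz => hdet ?_⟩
  rw [hfac, Matrix.det_mul, hz, mul_zero]

/-- Booleans: `(P ↔ β = true)` determines `decide P`. -/
theorem decide_eq_of_iff_eq_true {P : Prop} [Decidable P] {β : Bool} (hP : P ↔ β = true) :
    decide P = β := by
  cases β
  · exact decide_eq_false (fun hp => Bool.false_ne_true (hP.mp hp))
  · exact decide_eq_true (hP.mpr rfl)

/-- Booleans: `(P ↔ β = false)` makes `decide P ≠ β`. -/
theorem decide_ne_of_iff_eq_false {P : Prop} [Decidable P] {β : Bool} (hP : P ↔ β = false) :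
    decide P ≠ β := by
  cases β
  · rw [decide_eq_true (hP.mpr rfl)]; exact by decide
  · intro hh
    exact absurd (hP.mp (of_decide_eq_true hh)) (by decide)

/-! ## 2. R1: the item, verbatim -/

/-- **Item stmt-ValiantsHypothesis-19587 `TransversalLiteralPairSplit` (R1), signature VERBATIM.**
If the first `k` row points have `a`-bit `β` and the last `m` have `¬β`, the first `k` column
points have `c`-bit `γ` and the last `m` have `¬γ`, and both the projected `k`-block (one
dimension down) and the `m`-block (same dimension) are GOOD, then the layout is GOOD. Proof
(planner p1-g10's plan): by GENERICITY (`exists_common_witness`) one big `H₂` makes the `m`-block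
nonsingular and, through its off-part, the projected `k`-block; perturbing the single entry
(literal `(a, β)`, literal `(c, γ)`) of `H₂` by `z` changes exactly the `k × k` block of the layout
matrix, by `z · (−1)^{a+c} ·` (projected block of the off-part) (`det_submatrix_add_single`,
`det_submatrix_add_single_of_ne`); the block argument (`exists_det_fromBlocks_ne_zero`) gives a
good `z`. -/
theorem transversalLiteralPairSplit :
    ∀ (h k m : ℕ) (u w : Fin (k + m) → Finset (Fin (h + 1))) (a c : Fin (h + 1)) (β γ : Bool),
    (∀ i : Fin k, a ∈ u (Fin.castAdd m i) ↔ β = true) →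
    (∀ i : Fin m, a ∈ u (Fin.natAdd k i) ↔ β = false) →
    (∀ j : Fin k, c ∈ w (Fin.castAdd m j) ↔ γ = true) →
    (∀ j : Fin m, c ∈ w (Fin.natAdd k j) ↔ γ = false) →
    (∃ H : Matrix (Fin (h + h)) (Fin (h + h)) ℂ, (Matrix.of fun i j : Fin k =>
      (H.submatrix
        (fun b : Fin h => if b ∈ (Finset.univ.filter fun b : Fin h =>
            a.succAbove b ∈ u (Fin.castAdd m i)) then Fin.castAdd h b else Fin.natAdd h b)
        (fun b : Fin h => if b ∈ (Finset.univ.filter fun b : Fin h =>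
            c.succAbove b ∈ w (Fin.castAdd m j)) then Fin.natAdd h b else Fin.castAdd h b)).det).det
        ≠ 0) →
    (∃ H : Matrix (Fin ((h + 1) + (h + 1))) (Fin ((h + 1) + (h + 1))) ℂ,
      (Matrix.of fun i j : Fin m =>
        (H.submatrix
          (fun b : Fin (h + 1) => if b ∈ u (Fin.natAdd k i) then Fin.castAdd (h + 1) b
            else Fin.natAdd (h + 1) b)
          (fun b : Fin (h + 1) => if b ∈ w (Fin.natAdd k j) then Fin.natAdd (h + 1) b
            else Fin.castAdd (h + 1) b) ).det).det ≠ 0) →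
    ∃ H : Matrix (Fin ((h + 1) + (h + 1))) (Fin ((h + 1) + (h + 1))) ℂ,
      (Matrix.of fun i j : Fin (k + m) =>
        (H.submatrix
          (fun b : Fin (h + 1) => if b ∈ u i then Fin.castAdd (h + 1) b else Fin.natAdd (h + 1) b)
          (fun b : Fin (h + 1) => if b ∈ w j then Fin.natAdd (h + 1) b
            else Fin.castAdd (h + 1) b)).det).det ≠ 0 := by
  intro h k m u w a c β γ hU1 hU2 hW1 hW2 hgood1 hgood2
  classical
  -- projected first block
  set U1 : Fin k → Finset (Fin h) :=
    fun i => univ.filter (fun b : Fin h => a.succAbove b ∈ u (Fin.castAdd m i)) with hU1def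
  set W1 : Fin k → Finset (Fin h) :=
    fun j => univ.filter (fun b : Fin h => c.succAbove b ∈ w (Fin.castAdd m j)) with hW1def
  -- genericity: one matrix `H₂` good for the `m`-block and, via its off-part, for the `k`-block
  obtain ⟨H₂, hCk, hDm⟩ := exists_common_witness a c U1 W1
    (fun i => u (Fin.natAdd k i)) (fun j => w (Fin.natAdd k j)) hgood1 hgood2
  -- the blocks
  set A₀ : Matrix (Fin k) (Fin k) ℂ := Matrix.of fun i j =>
    (H₂.submatrix (rowL (u (Fin.castAdd m i))) (colL (w (Fin.castAdd m j)))).det with hA₀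
  set C' : Matrix (Fin k) (Fin k) ℂ := Matrix.of fun i j =>
    ((offPart a c H₂).submatrix (rowL (U1 i)) (colL (W1 j))).det with hC'
  set C₀ : Matrix (Fin k) (Fin k) ℂ := ((-1 : ℂ) ^ ((a : ℕ) + (c : ℕ))) • C' with hC₀
  set B₀ : Matrix (Fin k) (Fin m) ℂ := Matrix.of fun i j =>
    (H₂.submatrix (rowL (u (Fin.castAdd m i))) (colL (w (Fin.natAdd k j)))).det with hB₀
  set B₁ : Matrix (Fin m) (Fin k) ℂ := Matrix.of fun i j =>
    (H₂.submatrix (rowL (u (Fin.natAdd k i))) (colL (w (Fin.castAdd m j)))).det with hB₁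
  set D₀ : Matrix (Fin m) (Fin m) ℂ := Matrix.of fun i j =>
    (H₂.submatrix (rowL (u (Fin.natAdd k i))) (colL (w (Fin.natAdd k j)))).det with hD₀
  have hC₀det : C₀.det ≠ 0 := by
    rw [hC₀, Matrix.det_smul]
    exact mul_ne_zero (pow_ne_zero _ (pow_ne_zero _ (neg_ne_zero.mpr one_ne_zero))) hCk
  obtain ⟨z, hz⟩ := exists_det_fromBlocks_ne_zero A₀ C₀ B₀ B₁ D₀ hC₀det hDm
  refine ⟨H₂ + z • single a c β γ, ?_⟩
  -- the perturbed layout matrix, block by block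
  have hblocks : (Matrix.of fun i j : Fin (k + m) =>
      ((H₂ + z • single a c β γ).submatrix (rowL (u i)) (colL (w j))).det).submatrix
        finSumFinEquiv finSumFinEquiv = Matrix.fromBlocks (A₀ + z • C₀) B₀ B₁ D₀ := by
    ext i j
    rcases i with i | i <;> rcases j with j | j
    · rw [Matrix.submatrix_apply, Matrix.fromBlocks_apply₁₁, finSumFinEquiv_apply_left,
        finSumFinEquiv_apply_left, Matrix.of_apply,
        det_submatrix_add_single a c β γ H₂ z _ _ (decide_eq_of_iff_eq_true (hU1 i))
          (decide_eq_of_iff_eq_true (hW1 j)),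
        Matrix.add_apply, Matrix.smul_apply, smul_eq_mul, hA₀, Matrix.of_apply, hC₀,
        Matrix.smul_apply, smul_eq_mul, hC', Matrix.of_apply]
    · rw [Matrix.submatrix_apply, Matrix.fromBlocks_apply₁₂, finSumFinEquiv_apply_left,
        finSumFinEquiv_apply_right, Matrix.of_apply,
        det_submatrix_add_single_of_ne a c β γ H₂ z _ _
          (Or.inr (decide_ne_of_iff_eq_false (hW2 j))),
        hB₀, Matrix.of_apply]
    · rw [Matrix.submatrix_apply, Matrix.fromBlocks_apply₂₁, finSumFinEquiv_apply_right,
        finSumFinEquiv_apply_left, Matrix.of_apply,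
        det_submatrix_add_single_of_ne a c β γ H₂ z _ _
          (Or.inl (decide_ne_of_iff_eq_false (hU2 i))),
        hB₁, Matrix.of_apply]
    · rw [Matrix.submatrix_apply, Matrix.fromBlocks_apply₂₂, finSumFinEquiv_apply_right,
        finSumFinEquiv_apply_right, Matrix.of_apply,
        det_submatrix_add_single_of_ne a c β γ H₂ z _ _
          (Or.inl (decide_ne_of_iff_eq_false (hU2 i))),
        hD₀, Matrix.of_apply]
  have hdet : (Matrix.of fun i j : Fin (k + m) =>
      ((H₂ + z • single a c β γ).submatrix (rowL (u i)) (colL (w j))).det).det ≠ 0 := by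
    rw [← Matrix.det_submatrix_equiv_self finSumFinEquiv, hblocks]
    exact hz
  exact hdet

/-! ## 3. Literal expansions of transversal minors (the common generalisation of R1/R2; tool) -/

/-- **COLUMN-LITERAL EXPANSION.** Laplace expansion of the transversal minor `Θ_H[x, y]` along the
column of coordinate `c`:
`Θ_H[x,y] = Σ_b (−1)^{b+c} · H[ρ_x b, κ_y c] · Θ_{offPart b c H}[x⁽ᵇ⁾, y⁽ᶜ⁾]` (projected points
`x⁽ᵇ⁾ = {b' | b.succAbove b' ∈ x}`). The literal-block lift (R2) and the
one-entry perturbation (R1) are the cases where all but one term vanish. -/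
theorem det_submatrix_colExpansion
    (H : Matrix (Fin ((h + 1) + (h + 1))) (Fin ((h + 1) + (h + 1))) ℂ)
    (x y : Finset (Fin (h + 1))) (c : Fin (h + 1)) :
    (H.submatrix (rowL x) (colL y)).det =
      ∑ b : Fin (h + 1), (-1) ^ ((b : ℕ) + (c : ℕ)) * H (rowL x b) (colL y c) *
        ((offPart b c H).submatrix (rowL (univ.filter (fun b' : Fin h => b.succAbove b' ∈ x)))
          (colL (univ.filter (fun b' : Fin h => c.succAbove b' ∈ y)))).det := by
  rw [Matrix.det_succ_column _ c]
  refine Finset.sum_congr rfl (fun b _ => ?_)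
  rw [Matrix.submatrix_apply]
  congr 2
  ext i j
  rw [Matrix.submatrix_apply, Matrix.submatrix_apply, Matrix.submatrix_apply]
  unfold offPart
  rw [embRow_rowL, embCol_colL]

/-- **ROW-LITERAL EXPANSION** (along the row of coordinate `a`). -/
theorem det_submatrix_rowExpansion
    (H : Matrix (Fin ((h + 1) + (h + 1))) (Fin ((h + 1) + (h + 1))) ℂ)
    (x y : Finset (Fin (h + 1))) (a : Fin (h + 1)) :
    (H.submatrix (rowL x) (colL y)).det =
      ∑ d : Fin (h + 1), (-1) ^ ((a : ℕ) + (d : ℕ)) * H (rowL x a) (colL y d) *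
        ((offPart a d H).submatrix (rowL (univ.filter (fun b' : Fin h => a.succAbove b' ∈ x)))
          (colL (univ.filter (fun b' : Fin h => d.succAbove b' ∈ y)))).det := by
  rw [Matrix.det_succ_row _ a]
  refine Finset.sum_congr rfl (fun d _ => ?_)
  rw [Matrix.submatrix_apply]
  congr 2
  ext i j
  rw [Matrix.submatrix_apply, Matrix.submatrix_apply, Matrix.submatrix_apply]
  unfold offPart
  rw [embRow_rowL, embCol_colL]

/-- **Item stmt-ValiantsHypothesis-19587 `TransversalLiteralPairSplit` (R1) holds**, typed by the
route declaration (this module imports the route file, so the gate's type match closes the item and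
no `_holds` link is stated there). -/
theorem transversalLiteralPairSplit_route :
    Summit.ValiantsHypothesis.ValiantsHypothesis.Theses.BarrierLever.TransversalLiteralPairSplit :=
  transversalLiteralPairSplit

end Summit.ValiantsHypothesis.ValiantsHypothesis.Theorems.BarrierLever.LiteralSplit
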